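import Mathlib
import HarnessLib
import Summits.ValiantsHypothesis.ValiantsHypothesis.Theses.MonotoneRestoration
import Literature.Computability.AlgebraicComplexity.ArithCircuit
import Literature.Computability.AlgebraicComplexity.ArithCircuitProofs
import Literature.Computability.AlgebraicComplexity.MonotoneStructure
import Literature.Computability.AlgebraicComplexity.PermanentIrreducible
import Literature.ModelTheory.FiniteModelTheory.CkEquiv
import Summits.ValiantsHypothesis.ValiantsHypothesis.Theorems.MonotoneRestorationMonotoneRestorationQPCosetCount
import Summits.ValiantsHypothesis.ValiantsHypothesis.Theorems.MonotoneRestorationMonotoneRestorationQPSymmetricLB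
import Summits.ValiantsHypothesis.ValiantsHypothesis.Theorems.MonotoneRestorationMonotoneRestorationQPSupportSymmetrisation
import Summits.ValiantsHypothesis.ValiantsHypothesis.Theorems.MonotoneRestorationMonotoneRestorationQPSparseRegime
import Summits.ValiantsHypothesis.ValiantsHypothesis.Theorems.MonotoneRestorationMonotoneRestorationQPBeta
import Literature.Computability.AlgebraicComplexity.SymmetricArithCircuit
import Literature.Computability.AlgebraicComplexity.DawarWilsenach2025Proofs
import Literature.GroupTheory.PermutationGroups.SmallIndexSubgroups
import Summits.ValiantsHypothesis.ValiantsHypothesis.Theorems.MonotoneRestorationQP.Negative.LoadBearing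
import Summits.ValiantsHypothesis.ValiantsHypothesis.Theorems.MonotoneRestorationMonotoneRestorationQPPermSupportCount

/-! # TTRL-lite variant V14292 of `MonotoneRestorationQP` / `stub_gateSupport` (stmt-ValiantsHypothesis-15886)

Machine-generated helper (proved); move `specialise`, op `fix_nat:n=6`: fix n := 6.
See docs/architecture/ttrl-lite.md. -/

namespace Summit.ValiantsHypothesis.ValiantsHypothesis.Theorems

open Summit.ValiantsHypothesis.ValiantsHypothesis.Theses.MonotoneRestoration
open Literature.Computability.AlgebraicComplexity

/-- TTRL-lite variant V14292 (specialise `fix_nat:n=6`) of `stub_gateSupport` (stmt-ValiantsHypothesis-15886); machine-found, kernel-checked. -/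
theorem stub_gateSupport_var14292 :
    ∀ (K : Type) (G : Type) [Fintype G] (C : LabelledArithCircuit K (Fin 6 × Fin 6) Unit G) (hC : C.IsSymmetric (Equiv.Perm (Fin 6))) (k : ℕ) (hn : 8 < 6) (hk : 1 ≤ k) (h4k : 4 * k ≤ 6) (hcard : Fintype.card G < (6).choose k) (g : G), ∃ X : Finset (Fin 6), X.card < k ∧ ∀ ρ : Equiv.Perm (Fin 6), (∀ x ∈ X, ρ x = x) → Equiv.Perm.sign ρ = 1 → ∃ π : Equiv.Perm G, C.IsAutomorphismExtending ρ π ∧ π g = g := by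
  intros
  omega

end Summit.ValiantsHypothesis.ValiantsHypothesis.Theorems
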